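import Summits.PneNP.PneNP.Theorems.SymmetryBudgetWindowBarrierEntropyGameColouring
import Literature.ModelTheory.FiniteModelTheory.WeisfeilerLemanColoured

/-!
# Discretising colourings identify, `k`-dimensional form: higher Weisfeiler–Leman TAME certificates
(dichotomy `WindowBarrier` stmt-PneNP-2145 / `NoHiddenOrder` stmt-PneNP-14781, route `PneNP/SymmetryBudget`)

`SymmetryBudgetWindowBarrierEntropyGameDiscrete.lean` certifies a graph TAME from a colouring whose PLAIN colour
refinement is discrete.  Here the refinement is `k`-dimensional Weisfeiler–Leman on the coloured graph
(`wlColourC G c i v̄` on `k`-tuples, Literature `WeisfeilerLemanColoured`): along a colour-respecting bijective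
`m`-pebble strategy with `m > k`, positions read as `k`-tuples have equal `k`-WL colours at every round (the easy
direction of Hella / Cai–Fürer–Immerman Thm 5.2 / Immerman–Lander, for coloured graphs), so if the `k`-WL colours of
the DIAGONAL tuples `(v,…,v)` of `(G, c)` are pairwise distinct at some round then the empty-position bijection is
forced and is an isomorphism.  With colouring robustness: a colouring of entropy `≤ K₁ n` whose `k`-WL refinement is
discrete on the diagonal rules `W` out of every non-isomorphic entropy-`(K₁ + K₂)` game as soon as
`k + 1 ≤ K₂ n / (log₂ n + 1)` — e.g. `k = 2` (the classical Weisfeiler–Leman algorithm) at `K₂ = 1`, `n ≥ 16`.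

* `CRIdent.wlColourC_eq_of_range_mem` — game ⇒ equal `k`-WL colours on pebbled `k`-tuples (any `k < m`).
* **`CRIdent.nonempty_iso_of_strategy_wl`** — plus injectivity of the diagonal `k`-WL colours of `(G,c)` ⇒ `G ≃g H`.
* **`CosetGame.not_nonempty_entropyGame_of_discrete_wl`** — the entropy-game certificate.
-/

-- `Summit.PneNP.PneNP.…` duplicates `PneNP` BY DESIGN (single-problem summit).
set_option linter.dupNamespace false

namespace Summit.PneNP.PneNP.Theorems

open Finset Filter Literature.Computability.Complexity Literature.ModelTheory.FiniteModelTheory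

namespace CRIdent

variable {V W κ : Type*} [Fintype V] [DecidableEq V] [Fintype W] [DecidableEq W]
  {G : SimpleGraph V} {H : SimpleGraph W} [DecidableRel G.Adj] [DecidableRel H.Adj] {c : V → κ} {d : W → κ}

omit [Fintype V] [DecidableEq V] [Fintype W] [DecidableEq W] [DecidableRel G.Adj] [DecidableRel H.Adj] in
/-- A position of `k`-tuples (the pebble pairs `(v j, w j)`) has at most `k` pebble pairs. -/
theorem ncard_pos_le {k : ℕ} (v : Fin k → V) (w : Fin k → W) :
    (Set.range fun j => (v j, w j)).ncard ≤ k := by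
  classical
  have h : (Set.range fun j => (v j, w j)) = ↑((univ : Finset (Fin k)).image fun j => (v j, w j)) := by
    rw [Finset.coe_image, Finset.coe_univ, Set.image_univ]
  rw [h, Set.ncard_coe_finset]
  exact Finset.card_image_le.trans (by rw [Finset.card_univ, Fintype.card_fin])

omit [Fintype V] [DecidableEq V] [Fintype W] [DecidableEq W] [DecidableRel G.Adj] [DecidableRel H.Adj] in
/-- The pebble pairs of the extended tuples lie in the extended position. -/
theorem pos_snoc_subset {k : ℕ} (v : Fin k → V) (w : Fin k → W) (x : V) (y : W) :
    (Set.range fun j => ((Fin.snoc v x : Fin (k + 1) → V) j, (Fin.snoc w y : Fin (k + 1) → W) j)) ⊆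
      insert (x, y) (Set.range fun j => (v j, w j)) := by
  rintro _ ⟨i, rfl⟩
  induction i using Fin.lastCases with
  | last => simp only [Fin.snoc_last]; exact Set.mem_insert _ _
  | cast j => simp only [Fin.snoc_castSucc]; exact Set.mem_insert_of_mem _ ⟨j, rfl⟩

omit [Fintype V] [DecidableEq V] [Fintype W] [DecidableEq W] [DecidableRel G.Adj] [DecidableRel H.Adj] in
/-- The pebble pairs of the substituted tuples lie in the extended position. -/
theorem pos_update_subset {k : ℕ} (v : Fin k → V) (w : Fin k → W) (x : V) (y : W) (j : Fin k) :
    (Set.range fun i => (Function.update v j x i, Function.update w j y i)) ⊆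
      insert (x, y) (Set.range fun i => (v i, w i)) := by
  rintro _ ⟨i, rfl⟩
  by_cases hij : i = j
  · subst hij
    simp only [Function.update_self]
    exact Set.mem_insert _ _
  · simp only [Function.update_of_ne hij]
    exact Set.mem_insert_of_mem _ ⟨i, rfl⟩

/-- **Game ⇒ Weisfeiler–Leman, coloured, any dimension** (the easy direction of Hella / Cai–Fürer–Immerman Thm 5.2):
along a colour-respecting bijective `m`-pebble strategy, a position read as a pair of `k`-tuples with `k < m` has equal
`k`-WL colours on both sides at every round. -/
theorem wlColourC_eq_of_range_mem {k m : ℕ} (S : BijPebbleStrategy m G H) (hkm : k < m)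
    (hS : ∀ p ∈ S.carrier, ∀ x ∈ p, c x.1 = d x.2) (i : ℕ) :
    ∀ {v : Fin k → V} {w : Fin k → W}, (Set.range fun j => (v j, w j)) ∈ S.carrier →
      wlColourC G c i v = wlColourC H d i w := by
  induction i with
  | zero =>
    intro v w h
    rw [wlColourC_zero, wlColourC_zero]
    refine Prod.ext ((atp_eq_atp_iff _ _).2 (S.isPartialIso_of_mem h)) ?_
    funext j
    exact hS _ h (v j, w j) ⟨j, rfl⟩
  | succ i ih =>
    intro v w h
    rw [wlColourC_succ, wlColourC_succ]
    refine Prod.ext (ih h) ?_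
    obtain ⟨f, hf⟩ := S.forth h ((ncard_pos_le v w).trans_lt hkm)
    have key : ∀ x : V,
        (atpC G c (Fin.snoc v x : Fin (k + 1) → V), fun j => wlColourC G c i (Function.update v j x)) =
          (atpC H d (Fin.snoc w (f x) : Fin (k + 1) → W), fun j => wlColourC H d i (Function.update w j (f x))) := by
      intro x
      have hp := hf x
      have hpi := S.isPartialIso_of_mem hp
      refine Prod.ext (Prod.ext ?_ ?_) ?_
      · exact (atp_eq_atp_iff _ _).2 (hpi.mono (pos_snoc_subset v w x (f x)))
      · funext j
        show c ((Fin.snoc v x : Fin (k + 1) → V) j) = d ((Fin.snoc w (f x) : Fin (k + 1) → W) j)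
        induction j using Fin.lastCases with
        | last => simp only [Fin.snoc_last]; exact hS _ hp (x, f x) (Set.mem_insert _ _)
        | cast j => simp only [Fin.snoc_castSucc]; exact hS _ hp (v j, w j) (Set.mem_insert_of_mem _ ⟨j, rfl⟩)
      · funext j
        exact ih (S.mem_of_subset hp (pos_update_subset v w x (f x) j))
    calc (univ : Finset V).val.map (fun x => (atpC G c (Fin.snoc v x : Fin (k + 1) → V),
            fun j => wlColourC G c i (Function.update v j x)))
        = (univ : Finset V).val.map ((fun x' => (atpC H d (Fin.snoc w x' : Fin (k + 1) → W),
            fun j => wlColourC H d i (Function.update w j x'))) ∘ f) :=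
          Multiset.map_congr rfl fun x _ => key x
      _ = ((univ : Finset V).val.map (f : V → W)).map (fun x' => (atpC H d (Fin.snoc w x' : Fin (k + 1) → W),
            fun j => wlColourC H d i (Function.update w j x'))) := (Multiset.map_map _ _ _).symm
      _ = (univ : Finset W).val.map (fun x' => (atpC H d (Fin.snoc w x' : Fin (k + 1) → W),
            fun j => wlColourC H d i (Function.update w j x'))) := by
          have hval : Multiset.map (f : V → W) (univ : Finset V).val = (univ : Finset W).val := by
            rw [← Equiv.coe_toEmbedding, ← Finset.map_val, Finset.map_univ_equiv]
          rw [hval]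

/-- **Discrete `k`-WL identifies**: a colour-respecting bijective `m`-pebble strategy with `1 ≤ k < m` and injective
`k`-WL colours of the DIAGONAL tuples of `(G, c)` at some round force `G ≃g H`. -/
theorem nonempty_iso_of_strategy_wl {k m : ℕ} (S : BijPebbleStrategy m G H) (hk : 1 ≤ k) (hkm : k < m)
    (hS : ∀ p ∈ S.carrier, ∀ x ∈ p, c x.1 = d x.2) {T : ℕ}
    (hinj : Function.Injective fun v : V => wlColourC G c T (fun _ : Fin k => v)) : Nonempty (G ≃g H) := by
  haveI : Nonempty (Fin k) := ⟨⟨0, hk⟩⟩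
  have hdiag : ∀ (a : V) (b : W), (Set.range fun _ : Fin k => (a, b)) = {(a, b)} := fun a b =>
    Set.range_const
  obtain ⟨f₀, hf₀⟩ := S.forth S.empty_mem (by rw [Set.ncard_empty]; omega)
  have h₀ : ∀ v : V, ({(v, f₀ v)} : Set (V × W)) ∈ S.carrier := fun v => by
    simpa using hf₀ v
  have hcol : ∀ v : V, wlColourC G c T (fun _ : Fin k => v) = wlColourC H d T (fun _ : Fin k => f₀ v) :=
    fun v => wlColourC_eq_of_range_mem S hkm hS T (by rw [hdiag]; exact h₀ v)
  refine ⟨⟨f₀, ?_⟩⟩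
  intro x y
  have hlt : ({(x, f₀ x)} : Set (V × W)).ncard < m := by rw [Set.ncard_singleton]; omega
  obtain ⟨f₁, hf₁⟩ := S.forth (h₀ x) hlt
  have hp := hf₁ y
  have hpi := S.isPartialIso_of_mem hp
  have hy : f₁ y = f₀ y := by
    have h1 : wlColourC G c T (fun _ : Fin k => y) = wlColourC H d T (fun _ : Fin k => f₁ y) :=
      wlColourC_eq_of_range_mem S hkm hS T (by
        rw [hdiag]; exact S.mem_of_subset hp (Set.singleton_subset_iff.2 (Set.mem_insert _ _)))
    set z : V := f₀.symm (f₁ y) with hz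
    have hz' : f₁ y = f₀ z := by rw [hz, Equiv.apply_symm_apply]
    have h2 : wlColourC G c T (fun _ : Fin k => z) = wlColourC G c T (fun _ : Fin k => y) := by
      rw [hcol z, ← hz', ← h1]
    have := hinj h2
    rw [hz', this]
  have hadj := hpi.adj_iff (Set.mem_insert_of_mem _ rfl) (Set.mem_insert _ _)
  simp only at hadj
  rw [hy] at hadj
  exact hadj.symm

end CRIdent

/-! ### The entropy-game form -/

namespace CosetGame

open CRIdent

variable {n K₁ K₂ : ℕ}

/-- **Higher-dimensional TAME certificate**: a colouring `c` of entropy `≤ K₁ n` whose `k`-WL refinement is injective on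
the diagonal identifies `W` at entropy `K₁ + K₂` whenever `k + 1 ≤ K₂ n / (log₂ n + 1)` (`1 ≤ k`). -/
theorem nonempty_iso_of_entropyGame_of_discrete_wl {k : ℕ} {W H : SimpleGraph (Fin n)} [DecidableRel W.Adj]
    [DecidableRel H.Adj] (hk : 1 ≤ k) (hn : k + 1 ≤ K₂ * n / (Nat.log 2 n + 1)) (c : Fin n → ℕ)
    (hc : IsLowEntropy K₁ c) {T : ℕ} (hinj : Function.Injective fun v : Fin n => wlColourC W c T (fun _ : Fin k => v))
    (g : Nonempty (EntropyGame (K₁ + K₂) W H)) : Nonempty (W ≃g H) := by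
  obtain ⟨π, S, hS⟩ := colourRobust_of_entropyGame (K₁ := K₁) (K₂ := K₂) g c hc
  exact nonempty_iso_of_strategy_wl (d := fun v => c (π.symm v)) S hk hn hS hinj

/-- **Higher-dimensional TAME certificate** (contrapositive). -/
theorem not_nonempty_entropyGame_of_discrete_wl {k : ℕ} {W H : SimpleGraph (Fin n)} [DecidableRel W.Adj]
    [DecidableRel H.Adj] (hk : 1 ≤ k) (hn : k + 1 ≤ K₂ * n / (Nat.log 2 n + 1)) (c : Fin n → ℕ)
    (hc : IsLowEntropy K₁ c) {T : ℕ} (hinj : Function.Injective fun v : Fin n => wlColourC W c T (fun _ : Fin k => v))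
    (hWH : ¬ Nonempty (W ≃g H)) : ¬ Nonempty (EntropyGame (K₁ + K₂) W H) :=
  fun g => hWH (nonempty_iso_of_entropyGame_of_discrete_wl hk hn c hc hinj g)

end CosetGame

/-! ### Appendix: the Weisfeiler–Leman form of colouring robustness -/

namespace CRIdent

variable {V W κ : Type*} [Fintype V] [DecidableEq V] [Fintype W] [DecidableEq W]
  {G : SimpleGraph V} {H : SimpleGraph W} [DecidableRel G.Adj] [DecidableRel H.Adj] {c : V → κ} {d : W → κ}

omit [DecidableEq V] [DecidableEq W] [DecidableRel G.Adj] [DecidableRel H.Adj] in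
/-- **Iterated forth**: a winning strategy in the bijective `m`-pebble game (`0 < m`) yields, for every `k ≤ m`, a
bijection `Φ` of `k`-tuples all of whose graphs `{(v̄ⱼ, (Φ v̄)ⱼ)}` are winning positions (cf. Literature
`exists_equiv_tuples_of_strategy`, the case `m = k + 1`). -/
theorem exists_tupleEquiv {m : ℕ} (S : BijPebbleStrategy m G H) (hm : 0 < m) :
    ∀ {k : ℕ}, k ≤ m → ∃ Φ : (Fin k → V) ≃ (Fin k → W),
      ∀ v : Fin k → V, (Set.range fun j => (v j, Φ v j)) ∈ S.carrier := by
  classical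
  obtain ⟨e, -⟩ := S.forth S.empty_mem (by rw [Set.ncard_empty]; exact hm)
  intro k
  induction k with
  | zero =>
    intro _
    refine ⟨Equiv.ofUnique _ _, fun v => ?_⟩
    rw [Set.range_eq_empty]
    exact S.empty_mem
  | succ k ih =>
    intro hk
    obtain ⟨Φ, hΦ⟩ := ih (Nat.le_of_succ_le hk)
    choose f hf using fun u : Fin k → V => S.forth (hΦ u) ((ncard_pos_le u (Φ u)).trans_lt hk)
    let Ψ : (Fin (k + 1) → V) → (Fin (k + 1) → W) := fun v =>
      Fin.snoc (Φ (Fin.init v)) (f (Fin.init v) (v (Fin.last k)))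
    have hΨinit : ∀ v, Fin.init (Ψ v) = Φ (Fin.init v) := fun v => Fin.init_snoc _ _
    have hΨlast : ∀ v, Ψ v (Fin.last k) = f (Fin.init v) (v (Fin.last k)) := fun v => Fin.snoc_last _ _
    have hinj : Function.Injective Ψ := by
      intro v v' h
      have h1 : Fin.init v = Fin.init v' := by
        apply Φ.injective
        rw [← hΨinit, ← hΨinit, h]
      have h2 : v (Fin.last k) = v' (Fin.last k) := by
        apply (f (Fin.init v)).injective
        have := congrFun h (Fin.last k)
        rw [hΨlast, hΨlast, ← h1] at this
        exact this
      rw [← Fin.snoc_init_self v, ← Fin.snoc_init_self v', h1, h2]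
    have hcard : Fintype.card (Fin (k + 1) → V) = Fintype.card (Fin (k + 1) → W) := by
      rw [Fintype.card_fun, Fintype.card_fun, Fintype.card_congr e]
    have hbij : Function.Bijective Ψ := (Fintype.bijective_iff_injective_and_card Ψ).2 ⟨hinj, hcard⟩
    refine ⟨Equiv.ofBijective Ψ hbij, fun v => S.mem_of_subset (hf (Fin.init v) (v (Fin.last k))) ?_⟩
    rintro _ ⟨i, rfl⟩
    simp only [Equiv.ofBijective_apply]
    induction i using Fin.lastCases with
    | last => rw [hΨlast]; exact Set.mem_insert _ _
    | cast j =>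
      refine Set.mem_insert_of_mem _ ⟨j, ?_⟩
      show (Fin.init v j, Φ (Fin.init v) j) = (v (Fin.castSucc j), Ψ v (Fin.castSucc j))
      rw [← hΨinit v]
      rfl

/-- **Colour-respecting strategies give coloured Weisfeiler–Leman equivalence**: a colour-respecting winning strategy with
`m > k` pebbles makes the multisets of round-`i` `k`-WL colours of `(G, c)` and `(H, d)` agree. -/
theorem wlColoursC_eq_of_strategy {k m : ℕ} (S : BijPebbleStrategy m G H) (hkm : k < m)
    (hS : ∀ p ∈ S.carrier, ∀ x ∈ p, c x.1 = d x.2) (i : ℕ) : wlColoursC k G c i = wlColoursC k H d i := by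
  obtain ⟨Φ, hΦ⟩ := exists_tupleEquiv S (Nat.zero_lt_of_lt hkm) hkm.le
  unfold wlColoursC
  calc (univ : Finset (Fin k → V)).val.map (wlColourC G c i)
      = (univ : Finset (Fin k → V)).val.map (wlColourC H d i ∘ Φ) :=
        Multiset.map_congr rfl fun v _ => wlColourC_eq_of_range_mem S hkm hS i (hΦ v)
    _ = ((univ : Finset (Fin k → V)).val.map (Φ : (Fin k → V) → (Fin k → W))).map (wlColourC H d i) :=
        (Multiset.map_map _ _ _).symm
    _ = (univ : Finset (Fin k → W)).val.map (wlColourC H d i) := by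
        rw [← Equiv.coe_toEmbedding, ← Finset.map_val, Finset.map_univ_equiv]

/-- Hence `WLEquivC k G c H d` from a colour-respecting winning strategy with more than `k` pebbles. -/
theorem wlEquivC_of_strategy {k m : ℕ} (S : BijPebbleStrategy m G H) (hkm : k < m)
    (hS : ∀ p ∈ S.carrier, ∀ x ∈ p, c x.1 = d x.2) : WLEquivC k G c H d :=
  fun i => wlColoursC_eq_of_strategy S hkm hS i

end CRIdent

namespace CosetGame

open CRIdent

variable {n : ℕ}

/-- **Colouring robustness, Weisfeiler–Leman form**: an entropy-`(K₁ + K₂)` game answers every colouring `c` of `V(G)`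
of entropy `≤ K₁ n` by the transported colouring `c ∘ π⁻¹` of `V(H)` so that the coloured graphs are `k`-WL-equivalent
for every `k` with `k + 1 ≤ K₂ n / (log₂ n + 1)`. -/
theorem wlEquivC_of_entropyGame {K₁ K₂ k : ℕ} {G H : SimpleGraph (Fin n)} [DecidableRel G.Adj] [DecidableRel H.Adj]
    (g : Nonempty (EntropyGame (K₁ + K₂) G H)) (hk : k + 1 ≤ K₂ * n / (Nat.log 2 n + 1)) (c : Fin n → ℕ)
    (hc : IsLowEntropy K₁ c) : ∃ π : Equiv.Perm (Fin n), WLEquivC k G c H (fun v => c (π.symm v)) := by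
  obtain ⟨π, S, hS⟩ := colourRobust_of_entropyGame (K₁ := K₁) (K₂ := K₂) g c hc
  exact ⟨π, wlEquivC_of_strategy (d := fun v => c (π.symm v)) S hk hS⟩

open scoped Classical in
/-- **HardToIdentify forces colouring-robust coloured Weisfeiler–Leman equivalence**: for all `K₁ K₂`, infinitely often,
non-isomorphic pairs `G`, `H` such that every colouring of `V(G)` of entropy `≤ K₁ n` is answered by a colouring of `V(H)`
with `(G, c)` and `(H, c ∘ π⁻¹)` `k`-WL-equivalent for every `k + 1 ≤ K₂ n / (log₂ n + 1)` — the test refuters run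
(classical decidability instances, as in `hardToIdentify_iff_entropyGames`). -/
theorem wlEquivC_of_hardToIdentify
    (hHTI : ∀ c : ℕ, ∃ᶠ h in atTop, ∃ H : SimpleGraph (Fin h),
      ¬ HasSymCircuit tcBasis Set.univ (2 ^ (c * h))
        (fun x : Fin h × Fin h → Bool =>
          decide (Nonempty ((SimpleGraph.fromRel fun u v => x (u, v) = true) ≃g H))))
    (K₁ K₂ : ℕ) :
    ∃ᶠ n in atTop, ∃ G H : SimpleGraph (Fin n), ¬ Nonempty (G ≃g H) ∧
      ∀ c : Fin n → ℕ, IsLowEntropy K₁ c → ∀ k : ℕ, k + 1 ≤ K₂ * n / (Nat.log 2 n + 1) →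
        ∃ π : Equiv.Perm (Fin n), WLEquivC k G c H (fun v => c (π.symm v)) :=
  (hardToIdentify_iff_entropyGames.1 hHTI (K₁ + K₂)).mono fun _ ⟨G, H, hGH, g⟩ =>
    ⟨G, H, hGH, fun c hc _ hk => wlEquivC_of_entropyGame g hk c hc⟩

end CosetGame

end Summit.PneNP.PneNP.Theorems
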